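import Summits.AtomisticToContinuum.Crystallization.Theorems.OverbindingBudgetAffineCompressedCutExact
import Summits.AtomisticToContinuum.Crystallization.Theorems.OverbindingBudgetAffineCompressedCutKernel

/-!
(SPLIT FOR THE 400-LINE CAP by the landing lane, hand-2 g37: this file = part 1 of 2 (§1–§3); the sequel `…CompressedCutCharts` (§4 registration and the child chart, §5 packaged kernel steps) imports it; same namespace / opens / variables, all FQNs unchanged.)
# NODE g81 «ExactStep», toward the open leaf NS♭₂ — CHARTS: from exact dictionaries to the exact adjacency kernel (rider R1, integer side)

Route `OverbindingBudget` (Crystallization), crux `RobustDefectLimitWindows` (stmt-AtomisticToContinuum-31280), decomp-a2c lens 4, generation 81.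
Companion of `…CompressedCutExact` (the exact dictionary `ExactDict` of a registered bond and its cocycle) and `…CompressedCutKernel` (the Boolean adjacency
kernel over integer triples `T3`, read through `RegAt` / `PullsInto` / `kernelOneB_sound` / `kernelTwoB_sound`).  This file is the BRIDGE between them:

* §1 model points `mv V = (toV V)/√18` of integer triples (`mv_tsub/tadd/tneg/tscale`, `mv_injective`, `norm_mv_eq_one_iff`) and `ListedBy P S` (a real
  pattern is exactly the set of model points of a list; `listedBy_fcc`, `listedBy_hcp`);
* §2 CHARTS: `Carries M P C` — the linear isometry `M` carries the real pattern `P` of a site onto the model points of the copy `C` (both directions);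
  `ChartDict G Gp Pp v_k P'` — the chart form of an exact dictionary (child chart `G = M ∘ R₁`, parent chart `Gp = M`), obtained from `ExactDict` directly
  (`chartDict_of_exactDict`) or through the cocycle for a second parent (`chartDict_of_cocycle`);
* §3 `mv_tpull`: along a frame pair carried by `G`, the kernel's pull-back is `d • G` on model points (`d = tdet = ±54`, `tdet_of_unitTriple`);
  `exists_unitTriple_of_chartDict`: for ANY tetrahedral frame `(x; b, c)` of the parent's copy the child's list contains a unit triple carried onto the partners
  `−x, b − x, c − x` (so the kernel may use its own `tetraPick` frame — obligation O5);
* §4 ★ `regAt_of_chartDict` (the kernel's registration hypothesis `RegAt` holds for every parent with a chart-form dictionary) and ★ `carries_of_pullsInto`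
  (the kernel's conclusion `PullsInto Q S …` makes `G` a chart of the child onto the copy `Q`, by injectivity and the count `18`);
* §5 ★★ `kernel_step_one` / `kernel_step_two`: the packaged single-parent and two-parent steps — kernel table entry + charts of the parents + dictionaries
  ⇒ the child is carried onto a copy from the table's family; `linearIndependent_of_chart` (the cocycle's independence hypothesis from an integer determinant).

Deps: tree only (`…CompressedCutExact`, `…CompressedCutKernel`).  No `instance`, no `notation`, no `set_option`, no new axioms, 0 sorry.
-/

namespace Summit.AtomisticToContinuum.Crystallization.Theorems.OverbindingBudgetAffineCompressedCutCharts

open Literature.Geometry.DiscreteGeometry (sqNormInt intVec intVec_sub intVec_injective det3Int cramerInt fccModelInt hcpModelInt fccTwoShellPattern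
  hcpTwoShellPattern fccTwoShellPattern_eq_image hcpTwoShellPattern_eq_image norm_sq_intVec_div)
open Summit.AtomisticToContinuum.Crystallization.Theorems.OverbindingBudgetAffineCompressedCutKernel (T3 tsub tadd tneg tscale tsq tdet tpull toV
  toV_apply_zero toV_apply_one toV_apply_two toV_tsub toV_tadd toV_tneg toV_tscale tsq_eq tdet_eq toV_tpull toV_injective RegAt PullsInto TetraAt UnitTriple
  tetraPick kernelOneB kernelTwoB kernelOneB_sound kernelTwoB_sound capL fccL hcpL mem_fccModelInt_iff mem_hcpModelInt_iff)
open Summit.AtomisticToContinuum.Crystallization.Theorems.OverbindingBudgetAffineCompressedCutTransfer (model_cramer tetra_det)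
open Summit.AtomisticToContinuum.Crystallization.Theorems.OverbindingBudgetAffineCompressedCutExact (ExactDict)

variable {N : ℕ}

/-! ## §1  Model points of integer triples; patterns listed by integer lists -/

/-- The model point `(toV V)/√18` of an integer triple `V`. [this file] -/
noncomputable def mv (V : T3) : EuclideanSpace ℝ (Fin 3) := (Real.sqrt 18)⁻¹ • intVec (toV V)

/-- `intVec` is additive. [folklore] -/
private theorem intVec_add' (v w : Fin 3 → ℤ) : intVec (v + w) = intVec v + intVec w := by
  ext i; simp [intVec]

/-- `intVec` commutes with integer scalars. [folklore] -/
private theorem intVec_zsmul' (n : ℤ) (v : Fin 3 → ℤ) : intVec (n • v) = (n : ℝ) • intVec v := by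
  ext i; simp [intVec]

/-- `intVec` of negatives. [folklore] -/
private theorem intVec_neg' (v : Fin 3 → ℤ) : intVec (-v) = -intVec v := by
  ext i; simp [intVec]

/-- `mv` of a difference. [this file] -/
theorem mv_tsub (a b : T3) : mv (tsub a b) = mv a - mv b := by
  rw [mv, mv, mv, toV_tsub, ← intVec_sub, smul_sub]

/-- `mv` of a sum. [this file] -/
theorem mv_tadd (a b : T3) : mv (tadd a b) = mv a + mv b := by
  rw [mv, mv, mv, toV_tadd, intVec_add', smul_add]

/-- `mv` of a negative. [this file] -/
theorem mv_tneg (a : T3) : mv (tneg a) = -mv a := by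
  rw [mv, mv, toV_tneg, intVec_neg', smul_neg]

/-- `mv` of an integer multiple. [this file] -/
theorem mv_tscale (k : ℤ) (a : T3) : mv (tscale k a) = (k : ℝ) • mv a := by
  rw [mv, mv, toV_tscale, intVec_zsmul', smul_comm]

/-- `mv` of the zero triple. [this file] -/
theorem mv_zero : mv (0, 0, 0) = 0 := by
  have h : intVec (toV (0, 0, 0)) = 0 := by
    ext i; fin_cases i <;> simp [intVec, toV]
  rw [mv, h, smul_zero]

/-- `mv` is injective. [this file] -/
theorem mv_injective : Function.Injective mv := by
  intro a b h
  have hs : (Real.sqrt 18)⁻¹ ≠ 0 := inv_ne_zero (Real.sqrt_ne_zero'.2 (by norm_num))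
  exact toV_injective (intVec_injective (smul_right_injective (EuclideanSpace ℝ (Fin 3)) hs h))

/-- `‖mv a‖² = tsq a / 18`. [this file] -/
theorem norm_mv_sq (a : T3) : ‖mv a‖ ^ 2 = (tsq a : ℝ) / 18 := by
  rw [mv, norm_sq_intVec_div, tsq_eq]

/-- `‖mv a‖ = 1 ↔ tsq a = 18` (first-shell model vectors). [this file] -/
theorem norm_mv_eq_one_iff (a : T3) : ‖mv a‖ = 1 ↔ tsq a = 18 := by
  have h2 := norm_mv_sq a
  constructor
  · intro h
    rw [h, one_pow] at h2
    have h3 : (tsq a : ℝ) = 18 := by linarith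
    exact_mod_cast h3
  · intro h
    rw [h] at h2
    have h3 : ‖mv a‖ ^ 2 = 1 ^ 2 := by rw [h2]; norm_num
    exact (pow_left_inj₀ (norm_nonneg _) zero_le_one two_ne_zero).mp h3

/-- `P` is LISTED BY `S`: the real pattern `P` is exactly the set of model points of the integer list `S`. [this file] -/
def ListedBy (P : Finset (EuclideanSpace ℝ (Fin 3))) (S : List T3) : Prop :=
  (∀ w ∈ P, ∃ W ∈ S, w = mv W) ∧ ∀ W ∈ S, mv W ∈ P

/-- The fcc two-shell pattern is listed by `fccL`. [this file] -/
theorem listedBy_fcc : ListedBy fccTwoShellPattern fccL := by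
  have himg : fccTwoShellPattern = fccModelInt.image fun v => (Real.sqrt 18)⁻¹ • intVec v := by
    rw [fccTwoShellPattern_eq_image]; simp only [Nat.cast_ofNat]
  constructor
  · intro w hw
    rw [himg] at hw
    obtain ⟨W, hW, rfl⟩ := Finset.mem_image.1 hw
    obtain ⟨p, hp, hpW⟩ := (mem_fccModelInt_iff W).1 hW
    exact ⟨p, hp, by rw [mv, hpW]⟩
  · intro W hW
    rw [himg]
    exact Finset.mem_image_of_mem _ ((mem_fccModelInt_iff _).2 ⟨W, hW, rfl⟩)

/-- The hcp two-shell pattern is listed by `hcpL`. [this file] -/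
theorem listedBy_hcp : ListedBy hcpTwoShellPattern hcpL := by
  have himg : hcpTwoShellPattern = hcpModelInt.image fun v => (Real.sqrt 18)⁻¹ • intVec v := by
    rw [hcpTwoShellPattern_eq_image]; simp only [Nat.cast_ofNat]
  constructor
  · intro w hw
    rw [himg] at hw
    obtain ⟨W, hW, rfl⟩ := Finset.mem_image.1 hw
    obtain ⟨p, hp, hpW⟩ := (mem_hcpModelInt_iff W).1 hW
    exact ⟨p, hp, by rw [mv, hpW]⟩
  · intro W hW
    rw [himg]
    exact Finset.mem_image_of_mem _ ((mem_hcpModelInt_iff _).2 ⟨W, hW, rfl⟩)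

/-- Either two-shell pattern is listed by the corresponding model list. [this file] -/
theorem exists_listedBy {P : Finset (EuclideanSpace ℝ (Fin 3))} (hP : P = fccTwoShellPattern ∨ P = hcpTwoShellPattern) :
    ∃ S : List T3, (S = fccL ∨ S = hcpL) ∧ ListedBy P S := by
  rcases hP with rfl | rfl
  · exact ⟨fccL, Or.inl rfl, listedBy_fcc⟩
  · exact ⟨hcpL, Or.inr rfl, listedBy_hcp⟩

/-! ## §2  Charts and chart-form dictionaries -/

/-- **CHART.**  The linear isometry `M` CARRIES the real pattern `P` of a site onto the model points of the copy `C` (an integer list): every pattern point goes to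
a listed model point and every listed model point is hit. [this file] -/
def Carries (M : EuclideanSpace ℝ (Fin 3) →ₗᵢ[ℝ] EuclideanSpace ℝ (Fin 3)) (P : Finset (EuclideanSpace ℝ (Fin 3))) (C : List T3) : Prop :=
  (∀ v ∈ P, ∃ V ∈ C, M v = mv V) ∧ ∀ V ∈ C, ∃ v ∈ P, M v = mv V

/-- The identity carries a pattern onto any list listing it (the seed chart). [this file] -/
theorem carries_id_of_listedBy {P : Finset (EuclideanSpace ℝ (Fin 3))} {S : List T3} (h : ListedBy P S) :
    Carries LinearIsometry.id P S := by
  refine ⟨fun v hv => ?_, fun V hV => ⟨mv V, h.2 V hV, rfl⟩⟩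
  obtain ⟨W, hW, rfl⟩ := h.1 v hv
  exact ⟨W, hW, rfl⟩

/-- **CHART-FORM DICTIONARY** of a bond parent → child: child chart `G`, parent chart `Gp`, parent pattern `Pp` whose point `v_k` registers the child, child
pattern `P'`: the child's back-pointer is charted to `−Gp v_k`, and every parent point `v ≠ v_k` within the record reach has a child partner `w ∈ P'` with
`G w = Gp v − Gp v_k`. [this file] -/
def ChartDict (G Gp : EuclideanSpace ℝ (Fin 3) →ₗᵢ[ℝ] EuclideanSpace ℝ (Fin 3)) (Pp : Finset (EuclideanSpace ℝ (Fin 3))) (vk : EuclideanSpace ℝ (Fin 3))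
    (P' : Finset (EuclideanSpace ℝ (Fin 3))) : Prop :=
  (∃ w ∈ P', G w = -Gp vk) ∧ ∀ v ∈ Pp, v ≠ vk → ‖v - vk‖ ≤ 149 / 100 → ∃ w ∈ P', G w = Gp v - Gp vk

/-- An exact dictionary `R₁` of the bond `j → k` and a chart `M` of `j` give the chart-form dictionary with child chart `M ∘ R₁`. [this file] -/
theorem chartDict_of_exactDict {y : Fin N → EuclideanSpace ℝ (Fin 3)} {j : Fin N} {P P' : Finset (EuclideanSpace ℝ (Fin 3))}
    {f f' : EuclideanSpace ℝ (Fin 3) → EuclideanSpace ℝ (Fin 3)} {vk : EuclideanSpace ℝ (Fin 3)}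
    {R₁ : EuclideanSpace ℝ (Fin 3) →ₗᵢ[ℝ] EuclideanSpace ℝ (Fin 3)} (M : EuclideanSpace ℝ (Fin 3) →ₗᵢ[ℝ] EuclideanSpace ℝ (Fin 3))
    (h : ExactDict y j P P' f f' vk R₁) : ChartDict (M.comp R₁) M P vk P' := by
  refine ⟨?_, fun v hv hne hle => ?_⟩
  · obtain ⟨w₀, hw₀, -, hR⟩ := h.1
    exact ⟨w₀, hw₀, by rw [LinearIsometry.coe_comp, Function.comp_apply, hR, map_neg]⟩
  · obtain ⟨w, hw, -, hR⟩ := h.2 v hv hne hle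
    exact ⟨w, hw, by rw [LinearIsometry.coe_comp, Function.comp_apply, hR, map_sub]⟩

/-- Through the COCYCLE `R ∘ R₁' = R₁` (`…Exact.exactDict_cocycle`), the exact dictionary `R₁'` of the bond `j₂ → k` from a SECOND parent `j₂` (chart `M ∘ R`)
gives a chart-form dictionary for the SAME child chart `M ∘ R₁`. [this file] -/
theorem chartDict_of_cocycle {y : Fin N → EuclideanSpace ℝ (Fin 3)} {j₂ : Fin N} {P₂ P' : Finset (EuclideanSpace ℝ (Fin 3))}
    {f₂ f' : EuclideanSpace ℝ (Fin 3) → EuclideanSpace ℝ (Fin 3)} {vk' : EuclideanSpace ℝ (Fin 3)}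
    {R R₁ R₁' : EuclideanSpace ℝ (Fin 3) →ₗᵢ[ℝ] EuclideanSpace ℝ (Fin 3)} (M : EuclideanSpace ℝ (Fin 3) →ₗᵢ[ℝ] EuclideanSpace ℝ (Fin 3))
    (h : ExactDict y j₂ P₂ P' f₂ f' vk' R₁') (hc : ∀ x, R (R₁' x) = R₁ x) : ChartDict (M.comp R₁) (M.comp R) P₂ vk' P' := by
  refine ⟨?_, fun v hv hne hle => ?_⟩
  · obtain ⟨w₀, hw₀, -, hR⟩ := h.1
    refine ⟨w₀, hw₀, ?_⟩
    rw [LinearIsometry.coe_comp, LinearIsometry.coe_comp, Function.comp_apply, Function.comp_apply, ← hc, hR, map_neg, map_neg]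
  · obtain ⟨w, hw, -, hR⟩ := h.2 v hv hne hle
    refine ⟨w, hw, ?_⟩
    rw [LinearIsometry.coe_comp, LinearIsometry.coe_comp, Function.comp_apply, Function.comp_apply, Function.comp_apply, ← hc, hR, map_sub,
      map_sub]

/-! ## §3  The pull-back through a chart; unit triples from the dictionary -/

/-- Unit tetrahedral triples of the model lists are UNIMODULAR, `tdet = ±54` (the tree's `…Transfer.tetra_det`, by `decide`, through the `toV` bridge).
[this file] -/
theorem tdet_of_unitTriple {S : List T3} (hS : S = fccL ∨ S = hcpL) {w₁ w₂ w₃ : T3} (h₁ : w₁ ∈ S) (h₂ : w₂ ∈ S) (h₃ : w₃ ∈ S)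
    (hu : UnitTriple w₁ w₂ w₃) : tdet w₁ w₂ w₃ = 54 ∨ tdet w₁ w₂ w₃ = -54 := by
  obtain ⟨n₁, n₂, n₁₂, n₃, n₁₃, n₂₃⟩ := hu
  have hex : ∃ S' : Finset (Fin 3 → ℤ), (S' = fccModelInt ∨ S' = hcpModelInt) ∧ ∀ w ∈ S, toV w ∈ S' := by
    rcases hS with rfl | rfl
    · exact ⟨fccModelInt, Or.inl rfl, fun w hw => (mem_fccModelInt_iff _).2 ⟨w, hw, rfl⟩⟩
    · exact ⟨hcpModelInt, Or.inr rfl, fun w hw => (mem_hcpModelInt_iff _).2 ⟨w, hw, rfl⟩⟩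
  obtain ⟨S', hS', hmem⟩ := hex
  have key := tetra_det hS' _ (hmem w₁ h₁) _ (hmem w₂ h₂) _ (hmem w₃ h₃) (by rw [← tsq_eq]; exact n₁) (by rw [← tsq_eq]; exact n₂)
    (by rw [← tsq_eq]; exact n₃) (by rw [← toV_tsub, ← tsq_eq]; exact n₁₂) (by rw [← toV_tsub, ← tsq_eq]; exact n₁₃)
    (by rw [← toV_tsub, ← tsq_eq]; exact n₂₃)
  rwa [← tdet_eq] at key

/-- **PULL-BACK THROUGH A CHART.**  If the child chart `G` carries the unit triple `w₁, w₂, w₃` onto the partners `u₁, u₂, u₃` and `d = tdet w₁ w₂ w₃ ≠ 0`, then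
for every integer triple `W`: `mv (tpull u w W) = d • G (mv W)` (Cramer's rule `…Transfer.model_cramer` and `…Kernel.toV_tpull`). [this file] -/
theorem mv_tpull {G : EuclideanSpace ℝ (Fin 3) →ₗᵢ[ℝ] EuclideanSpace ℝ (Fin 3)} {u₁ u₂ u₃ w₁ w₂ w₃ : T3}
    (h₁ : G (mv w₁) = mv u₁) (h₂ : G (mv w₂) = mv u₂) (h₃ : G (mv w₃) = mv u₃) (hd : tdet w₁ w₂ w₃ ≠ 0) (W : T3) :
    mv (tpull u₁ u₂ u₃ w₁ w₂ w₃ W) = (tdet w₁ w₂ w₃ : ℝ) • G (mv W) := by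
  have hd' : det3Int (toV w₁) (toV w₂) (toV w₃) ≠ 0 := by rwa [← tdet_eq]
  have hdR : (det3Int (toV w₁) (toV w₂) (toV w₃) : ℝ) ≠ 0 := by exact_mod_cast hd'
  have hc : mv W = ((cramerInt (toV w₁) (toV w₂) (toV w₃) (toV W) 0 : ℝ) / det3Int (toV w₁) (toV w₂) (toV w₃)) • mv w₁
      + ((cramerInt (toV w₁) (toV w₂) (toV w₃) (toV W) 1 : ℝ) / det3Int (toV w₁) (toV w₂) (toV w₃)) • mv w₂
      + ((cramerInt (toV w₁) (toV w₂) (toV w₃) (toV W) 2 : ℝ) / det3Int (toV w₁) (toV w₂) (toV w₃)) • mv w₃ :=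
    model_cramer (toV w₁) (toV w₂) (toV w₃) (toV W) hd'
  have hsc : ∀ (c : ℝ) (x : EuclideanSpace ℝ (Fin 3)),
      (det3Int (toV w₁) (toV w₂) (toV w₃) : ℝ) • ((c / det3Int (toV w₁) (toV w₂) (toV w₃)) • x) = c • x := fun c x => by
    rw [smul_smul, mul_div_cancel₀ c hdR]
  rw [tdet_eq, hc, map_add, map_add, LinearIsometry.map_smul, LinearIsometry.map_smul, LinearIsometry.map_smul, h₁, h₂, h₃, smul_add, smul_add,
    hsc, hsc, hsc, mv, toV_tpull, intVec_add', intVec_add', intVec_zsmul', intVec_zsmul', intVec_zsmul', smul_add, smul_add, smul_comm _ (_ : ℝ) (intVec (toV u₁)),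
    smul_comm _ (_ : ℝ) (intVec (toV u₂)), smul_comm _ (_ : ℝ) (intVec (toV u₃))]
  rfl

/-- `tsq` of a negative. [this file] -/
private theorem tsq_tneg (a : T3) : tsq (tneg a) = tsq a := by
  obtain ⟨a₁, a₂, a₃⟩ := a
  simp only [tsq, tneg]
  ring

/-- `(−x) − (b − x) = −b`. [this file] -/
private theorem tsub_tneg_tsub (x b : T3) : tsub (tneg x) (tsub b x) = tneg b := by
  obtain ⟨x₁, x₂, x₃⟩ := x
  obtain ⟨b₁, b₂, b₃⟩ := b
  simp only [tsub, tneg, Prod.mk.injEq]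
  exact ⟨by ring, by ring, by ring⟩

/-- `(b − x) − (c − x) = b − c`. [this file] -/
private theorem tsub_tsub_tsub (b c x : T3) : tsub (tsub b x) (tsub c x) = tsub b c := by
  obtain ⟨x₁, x₂, x₃⟩ := x
  obtain ⟨b₁, b₂, b₃⟩ := b
  obtain ⟨c₁, c₂, c₃⟩ := c
  simp only [tsub, Prod.mk.injEq]
  exact ⟨by ring, by ring, by ring⟩

/-- Pattern points at norm distance `1` are distinct. [this file] -/
private theorem ne_of_norm_sub_eq_one {v w : EuclideanSpace ℝ (Fin 3)} (h : ‖v - w‖ = 1) : v ≠ w := fun e => by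
  rw [e, sub_self, norm_zero] at h
  exact zero_ne_one h

/-- **UNIT TRIPLES FROM THE DICTIONARY** (any frame — obligation O5).  A chart-form dictionary of a bond, the parent carried onto the copy `Cp` with `Gp v_k = mv x`
(`‖v_k‖ = 1`), and ANY tetrahedral frame `(x; b, c)` with `b, c ∈ Cp`: the child's list `S` contains a unit tetrahedral triple `W₁, W₂, W₃` carried by the child
chart `G` onto the frame partners `−x, b − x, c − x`. [this file] -/
theorem exists_unitTriple_of_chartDict {G Gp : EuclideanSpace ℝ (Fin 3) →ₗᵢ[ℝ] EuclideanSpace ℝ (Fin 3)} {Pp P' : Finset (EuclideanSpace ℝ (Fin 3))}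
    {vkp : EuclideanSpace ℝ (Fin 3)} {Cp S : List T3} {x b c : T3}
    (hD : ChartDict G Gp Pp vkp P') (hback : ∀ V ∈ Cp, ∃ v ∈ Pp, Gp v = mv V) (hx : Gp vkp = mv x) (hvk1 : ‖vkp‖ = 1)
    (hb : b ∈ Cp) (hc : c ∈ Cp) (ht : TetraAt x b c) (hS : ∀ w ∈ P', ∃ W ∈ S, w = mv W) :
    ∃ W₁ ∈ S, ∃ W₂ ∈ S, ∃ W₃ ∈ S, UnitTriple W₁ W₂ W₃ ∧
      G (mv W₁) = mv (tneg x) ∧ G (mv W₂) = mv (tsub b x) ∧ G (mv W₃) = mv (tsub c x) := by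
  obtain ⟨hb18, hbx, hc18, hcx, hbc⟩ := ht
  -- the partner of the parent's centre
  obtain ⟨w₁, hw₁, hGw₁⟩ := hD.1
  obtain ⟨W₁, hW₁, rfl⟩ := hS w₁ hw₁
  -- the partners of b and c
  obtain ⟨vb, hvb, hGvb⟩ := hback b hb
  have nb : ‖vb - vkp‖ = 1 := by rw [← Gp.norm_map, map_sub, hGvb, hx, ← mv_tsub, norm_mv_eq_one_iff]; exact hbx
  obtain ⟨w₂, hw₂, hGw₂⟩ := hD.2 vb hvb (ne_of_norm_sub_eq_one nb) (by rw [nb]; norm_num)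
  obtain ⟨W₂, hW₂, rfl⟩ := hS w₂ hw₂
  obtain ⟨vc, hvc, hGvc⟩ := hback c hc
  have nc : ‖vc - vkp‖ = 1 := by rw [← Gp.norm_map, map_sub, hGvc, hx, ← mv_tsub, norm_mv_eq_one_iff]; exact hcx
  obtain ⟨w₃, hw₃, hGw₃⟩ := hD.2 vc hvc (ne_of_norm_sub_eq_one nc) (by rw [nc]; norm_num)
  obtain ⟨W₃, hW₃, rfl⟩ := hS w₃ hw₃
  have e₁ : G (mv W₁) = mv (tneg x) := by rw [hGw₁, hx, mv_tneg]
  have e₂ : G (mv W₂) = mv (tsub b x) := by rw [hGw₂, hGvb, hx, mv_tsub]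
  have e₃ : G (mv W₃) = mv (tsub c x) := by rw [hGw₃, hGvc, hx, mv_tsub]
  refine ⟨W₁, hW₁, W₂, hW₂, W₃, hW₃, ?_, e₁, e₂, e₃⟩
  -- norms and distances through the isometry G
  have key : ∀ {W u : T3}, G (mv W) = mv u → tsq u = 18 → tsq W = 18 := fun {W u} h hu => by
    rw [← norm_mv_eq_one_iff, ← G.norm_map, h, norm_mv_eq_one_iff]; exact hu
  have key2 : ∀ {W W' u u' : T3}, G (mv W) = mv u → G (mv W') = mv u' → tsq (tsub u u') = 18 → tsq (tsub W W') = 18 :=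
    fun {W W' u u'} h h' hu => by
    rw [← norm_mv_eq_one_iff, mv_tsub, ← G.norm_map, map_sub, h, h', ← mv_tsub, norm_mv_eq_one_iff]; exact hu
  have hx18 : tsq x = 18 := by rw [← norm_mv_eq_one_iff, ← hx, Gp.norm_map]; exact hvk1
  have t1 : tsq (tneg x) = 18 := by rw [tsq_tneg]; exact hx18
  have t12 : tsq (tsub (tneg x) (tsub b x)) = 18 := by rw [tsub_tneg_tsub, tsq_tneg]; exact hb18
  have t13 : tsq (tsub (tneg x) (tsub c x)) = 18 := by rw [tsub_tneg_tsub, tsq_tneg]; exact hc18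
  have t23 : tsq (tsub (tsub b x) (tsub c x)) = 18 := by rw [tsub_tsub_tsub]; exact hbc
  exact ⟨key e₁ t1, key e₂ hbx, key2 e₁ e₂ t12, key e₃ hcx, key2 e₁ e₃ t13, key2 e₂ e₃ t23⟩

end Summit.AtomisticToContinuum.Crystallization.Theorems.OverbindingBudgetAffineCompressedCutCharts
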